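import Mathlib
import HarnessLib

/-!
# Contact formation, II: polynomial bounds for the curl certificate (real algebra)

Helper file (`--supports` stmt-AtomisticToContinuum-11749) for stub `stub_contactFormation` (R4) of the line
`cold-bath-relocation-walk` of the crux `JunctionLocality.ConductanceLowerBound` (lead c2 worker). Pure real-variable
inequalities (no chain, no measure): every local observable of the certificate — the forces
`F_0 = −(ω₂a + lam a³) + ((b−a) + β(b−a)³)`, `F_1 = −(ω₂b + lam b³) − ((b−a) + β(b−a)³) + ε((c−b) + β(c−b)³)`
(`a, b, c = q_0, q_1, q_{j₂}`, `ε ∈ [0,1]`), their Liouville derivatives `X_H F_0 = −(ω₂ + 3lam a²)d + (1 + 3β(b−a)²)(e−d)`,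
`X_H F_1 = −(ω₂ + 3lam b²)e − (1 + 3β(b−a)²)(e−d) + ε(1 + 3β(c−b)²)(f−e)` (`d, e, f = p_0, p_1, p_{j₂}`), the curl
`W = 1 + 3β(b−a)²`, the coefficients `A_0 = γF_1 + X_H F_1`, `A_1 = γF_0 + X_H F_0`, the test function `φ = dF_1 − eF_0` and its
source `k_φ = dA_0 − eA_1` — has its square bounded by `K · S⁴` with `S = 1 + a² + b² + c² + d² + e² + f²` and ONE constant
`K = K(ω₂, lam, β, γ)` (`contact_realBounds`, registered). Integrating `S⁴` against the Gibbs state then gives `L`-uniform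
second moments (`…ContactCertificateMoments`). Crude constants throughout; only their independence of the coordinates matters.
-/

namespace Summit.AtomisticToContinuum.FouriersLaw.Cruxes.ConductanceLowerBound.ColdBathRelocationWalk

/-! ## Shape lemmas -/

/-- Force shape: `(−(ω₂a + lam a³) + ((b−a) + β(b−a)³))² ≤ 4(ω₂² + lam² + 2 + 8β²) S³` whenever `1 + a² + b² ≤ S`. [folklore] -/
theorem contact_forceShape_sq_le (ω₂ lam β a b S : ℝ) (hS : 1 + a ^ 2 + b ^ 2 ≤ S) :
    (-(ω₂ * a + lam * a ^ 3) + ((b - a) + β * (b - a) ^ 3)) ^ 2 ≤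
      4 * (ω₂ ^ 2 + lam ^ 2 + 2 + 8 * β ^ 2) * S ^ 3 := by
  have hS1 : 1 ≤ S := by nlinarith [sq_nonneg a, sq_nonneg b]
  have ha : a ^ 2 ≤ S := by nlinarith [sq_nonneg b]
  have hr : (b - a) ^ 2 ≤ 2 * S := by nlinarith [sq_nonneg (a + b)]
  have hS3 : S ≤ S ^ 3 := le_self_pow₀ hS1 (by norm_num)
  have ha6 : (a ^ 2) ^ 3 ≤ S ^ 3 := pow_le_pow_left₀ (sq_nonneg a) ha 3
  have hr6 : ((b - a) ^ 2) ^ 3 ≤ (2 * S) ^ 3 := pow_le_pow_left₀ (sq_nonneg _) hr 3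
  have step : (-(ω₂ * a + lam * a ^ 3) + ((b - a) + β * (b - a) ^ 3)) ^ 2 ≤
      4 * (ω₂ ^ 2 * a ^ 2 + lam ^ 2 * (a ^ 2) ^ 3 + (b - a) ^ 2 + β ^ 2 * ((b - a) ^ 2) ^ 3) := by
    nlinarith [sq_nonneg (ω₂ * a - lam * a ^ 3), sq_nonneg (ω₂ * a + (b - a)), sq_nonneg (ω₂ * a + β * (b - a) ^ 3),
      sq_nonneg (lam * a ^ 3 + (b - a)), sq_nonneg (lam * a ^ 3 + β * (b - a) ^ 3),
      sq_nonneg ((b - a) - β * (b - a) ^ 3)]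
  nlinarith [mul_nonneg (sq_nonneg ω₂) (sub_nonneg.2 (ha.trans hS3)), mul_nonneg (sq_nonneg lam) (sub_nonneg.2 ha6),
    mul_nonneg (sq_nonneg β) (sub_nonneg.2 hr6)]

/-- Bond shape: `((c−b) + β(c−b)³)² ≤ (4 + 16β²) S³` whenever `1 + b² + c² ≤ S`. [folklore] -/
theorem contact_bondShape_sq_le (β b c S : ℝ) (hS : 1 + b ^ 2 + c ^ 2 ≤ S) :
    ((c - b) + β * (c - b) ^ 3) ^ 2 ≤ (4 + 16 * β ^ 2) * S ^ 3 := by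
  have hS1 : 1 ≤ S := by nlinarith [sq_nonneg b, sq_nonneg c]
  have hr : (c - b) ^ 2 ≤ 2 * S := by nlinarith [sq_nonneg (b + c)]
  have hS3 : S ≤ S ^ 3 := le_self_pow₀ hS1 (by norm_num)
  have hr6 : ((c - b) ^ 2) ^ 3 ≤ (2 * S) ^ 3 := pow_le_pow_left₀ (sq_nonneg _) hr 3
  have step : ((c - b) + β * (c - b) ^ 3) ^ 2 ≤ 2 * ((c - b) ^ 2 + β ^ 2 * ((c - b) ^ 2) ^ 3) := by
    nlinarith [sq_nonneg ((c - b) - β * (c - b) ^ 3)]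
  nlinarith [mul_nonneg (sq_nonneg β) (sub_nonneg.2 hr6)]

/-- Liouville-derivative shape: `(−(ω₂ + 3lam a²)d + (1 + 3β(b−a)²)(e−d))² ≤ 4(ω₂² + 9lam² + 2 + 72β²) S³` whenever
`1 + a² + b² + d² + e² ≤ S`. [folklore] -/
theorem contact_flowShape_sq_le (ω₂ lam β a b d e S : ℝ) (hS : 1 + a ^ 2 + b ^ 2 + d ^ 2 + e ^ 2 ≤ S) :
    (-(ω₂ + 3 * lam * a ^ 2) * d + (1 + 3 * β * (b - a) ^ 2) * (e - d)) ^ 2 ≤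
      4 * (ω₂ ^ 2 + 9 * lam ^ 2 + 2 + 72 * β ^ 2) * S ^ 3 := by
  have hS1 : 1 ≤ S := by nlinarith [sq_nonneg a, sq_nonneg b, sq_nonneg d, sq_nonneg e]
  have ha : a ^ 2 ≤ S := by nlinarith [sq_nonneg b, sq_nonneg d, sq_nonneg e]
  have hd : d ^ 2 ≤ S := by nlinarith [sq_nonneg a, sq_nonneg b, sq_nonneg e]
  have hr : (b - a) ^ 2 ≤ 2 * S := by nlinarith [sq_nonneg (a + b), sq_nonneg d, sq_nonneg e]
  have hed : (e - d) ^ 2 ≤ 2 * S := by nlinarith [sq_nonneg (e + d), sq_nonneg a, sq_nonneg b]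
  have hS3 : S ≤ S ^ 3 := le_self_pow₀ hS1 (by norm_num)
  have h0S : 0 ≤ S := zero_le_one.trans hS1
  -- the four monomials
  have m1 : d ^ 2 ≤ S ^ 3 := hd.trans hS3
  have m2 : (a ^ 2) ^ 2 * d ^ 2 ≤ S ^ 3 := by
    have h1 : (a ^ 2) ^ 2 ≤ S ^ 2 := pow_le_pow_left₀ (sq_nonneg a) ha 2
    calc (a ^ 2) ^ 2 * d ^ 2 ≤ S ^ 2 * S := mul_le_mul h1 hd (sq_nonneg d) (sq_nonneg S)
      _ = S ^ 3 := by ring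
  have m3 : (e - d) ^ 2 ≤ 2 * S ^ 3 := by nlinarith
  have m4 : ((b - a) ^ 2) ^ 2 * (e - d) ^ 2 ≤ 8 * S ^ 3 := by
    have h1 : ((b - a) ^ 2) ^ 2 ≤ (2 * S) ^ 2 := pow_le_pow_left₀ (sq_nonneg _) hr 2
    calc ((b - a) ^ 2) ^ 2 * (e - d) ^ 2 ≤ (2 * S) ^ 2 * (2 * S) :=
          mul_le_mul h1 hed (sq_nonneg _) (by positivity)
      _ = 8 * S ^ 3 := by ring
  have step : (-(ω₂ + 3 * lam * a ^ 2) * d + (1 + 3 * β * (b - a) ^ 2) * (e - d)) ^ 2 ≤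
      4 * (ω₂ ^ 2 * d ^ 2 + 9 * lam ^ 2 * ((a ^ 2) ^ 2 * d ^ 2) + (e - d) ^ 2 +
        9 * β ^ 2 * (((b - a) ^ 2) ^ 2 * (e - d) ^ 2)) := by
    nlinarith [sq_nonneg (ω₂ * d - 3 * lam * a ^ 2 * d), sq_nonneg (ω₂ * d + (e - d)),
      sq_nonneg (ω₂ * d + 3 * β * (b - a) ^ 2 * (e - d)), sq_nonneg (3 * lam * a ^ 2 * d + (e - d)),
      sq_nonneg (3 * lam * a ^ 2 * d + 3 * β * (b - a) ^ 2 * (e - d)),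
      sq_nonneg ((e - d) - 3 * β * (b - a) ^ 2 * (e - d))]
  nlinarith [mul_nonneg (sq_nonneg ω₂) (sub_nonneg.2 m1), mul_nonneg (sq_nonneg lam) (sub_nonneg.2 m2),
    mul_nonneg (sq_nonneg β) (sub_nonneg.2 m4)]

/-- Bond Liouville-derivative shape: `((1 + 3β(c−b)²)(f−e))² ≤ (4 + 144β²) S³` whenever `1 + b² + c² + e² + f² ≤ S`.
[folklore] -/
theorem contact_bondFlowShape_sq_le (β b c e f S : ℝ) (hS : 1 + b ^ 2 + c ^ 2 + e ^ 2 + f ^ 2 ≤ S) :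
    ((1 + 3 * β * (c - b) ^ 2) * (f - e)) ^ 2 ≤ (4 + 144 * β ^ 2) * S ^ 3 := by
  have hS1 : 1 ≤ S := by nlinarith [sq_nonneg b, sq_nonneg c, sq_nonneg e, sq_nonneg f]
  have hr : (c - b) ^ 2 ≤ 2 * S := by nlinarith [sq_nonneg (b + c), sq_nonneg e, sq_nonneg f]
  have hfe : (f - e) ^ 2 ≤ 2 * S := by nlinarith [sq_nonneg (e + f), sq_nonneg b, sq_nonneg c]
  have hS3 : S ≤ S ^ 3 := le_self_pow₀ hS1 (by norm_num)
  have m3 : (f - e) ^ 2 ≤ 2 * S ^ 3 := by nlinarith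
  have m4 : ((c - b) ^ 2) ^ 2 * (f - e) ^ 2 ≤ 8 * S ^ 3 := by
    have h1 : ((c - b) ^ 2) ^ 2 ≤ (2 * S) ^ 2 := pow_le_pow_left₀ (sq_nonneg _) hr 2
    calc ((c - b) ^ 2) ^ 2 * (f - e) ^ 2 ≤ (2 * S) ^ 2 * (2 * S) :=
          mul_le_mul h1 hfe (sq_nonneg _) (by positivity)
      _ = 8 * S ^ 3 := by ring
  have step : ((1 + 3 * β * (c - b) ^ 2) * (f - e)) ^ 2 ≤
      2 * ((f - e) ^ 2 + 9 * β ^ 2 * (((c - b) ^ 2) ^ 2 * (f - e) ^ 2)) := by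
    nlinarith [sq_nonneg ((f - e) - 3 * β * (c - b) ^ 2 * (f - e))]
  nlinarith [mul_nonneg (sq_nonneg β) (sub_nonneg.2 m4)]

/-- Curl shape: `(1 + 3β(b−a)²)² ≤ (2 + 72β²) S²` whenever `1 + a² + b² ≤ S`. [folklore] -/
theorem contact_curlShape_sq_le (β a b S : ℝ) (hS : 1 + a ^ 2 + b ^ 2 ≤ S) :
    (1 + 3 * β * (b - a) ^ 2) ^ 2 ≤ (2 + 72 * β ^ 2) * S ^ 2 := by
  have hS1 : 1 ≤ S := by nlinarith [sq_nonneg a, sq_nonneg b]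
  have hr : (b - a) ^ 2 ≤ 2 * S := by nlinarith [sq_nonneg (a + b)]
  have hS2 : 1 ≤ S ^ 2 := one_le_pow₀ hS1
  have m : ((b - a) ^ 2) ^ 2 ≤ 4 * S ^ 2 := by
    have h1 : ((b - a) ^ 2) ^ 2 ≤ (2 * S) ^ 2 := pow_le_pow_left₀ (sq_nonneg _) hr 2
    nlinarith
  have step : (1 + 3 * β * (b - a) ^ 2) ^ 2 ≤ 2 * (1 + 9 * β ^ 2 * ((b - a) ^ 2) ^ 2) := by
    nlinarith [sq_nonneg (1 - 3 * β * (b - a) ^ 2)]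
  nlinarith [mul_nonneg (sq_nonneg β) (sub_nonneg.2 m)]

/-! ## One constant for all seven observables -/

/-- `(u + εv)² ≤ 2u² + 2v²` for `ε ∈ [0, 1]`. [folklore] -/
theorem contact_sq_add_eps_mul_le (u v ε : ℝ) (hε0 : 0 ≤ ε) (hε1 : ε ≤ 1) : (u + ε * v) ^ 2 ≤ 2 * u ^ 2 + 2 * v ^ 2 := by
  have hε2 : ε ^ 2 ≤ 1 := by nlinarith
  have h1 : (u + ε * v) ^ 2 ≤ 2 * u ^ 2 + 2 * (ε ^ 2 * v ^ 2) := by nlinarith [sq_nonneg (u - ε * v)]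
  nlinarith [mul_nonneg (sub_nonneg.2 hε2) (sq_nonneg v)]

/-- `(γu + v)² ≤ 2γ²u² + 2v²`. [folklore] -/
theorem contact_sq_gamma_mul_add_le (γ u v : ℝ) : (γ * u + v) ^ 2 ≤ 2 * γ ^ 2 * u ^ 2 + 2 * v ^ 2 := by
  nlinarith [sq_nonneg (γ * u - v)]

/-- `(du − ev)² ≤ 2S(u² + v²)` when `d², e² ≤ S`. [folklore] -/
theorem contact_sq_sub_mul_le {d e S : ℝ} (hd : d ^ 2 ≤ S) (he : e ^ 2 ≤ S) (u v : ℝ) :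
    (d * u - e * v) ^ 2 ≤ 2 * S * (u ^ 2 + v ^ 2) := by
  have h1 : (d * u - e * v) ^ 2 ≤ 2 * (d ^ 2 * u ^ 2) + 2 * (e ^ 2 * v ^ 2) := by nlinarith [sq_nonneg (d * u + e * v)]
  nlinarith [mul_le_mul_of_nonneg_right hd (sq_nonneg u), mul_le_mul_of_nonneg_right he (sq_nonneg v)]

/-- The bookkeeping behind `contact_realBounds`, with the seven pieces abstracted: from the shape bounds on `S³` (resp. `S²`)
to one constant on `S⁴`. [folklore] -/
theorem contact_realBounds_aux (ω₂ lam β γ : ℝ) : ∃ K : ℝ, 0 < K ∧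
    ∀ (ε d e S PF0 G Bd PX0 X1 Xb PW : ℝ), 0 ≤ ε → ε ≤ 1 → 1 ≤ S → d ^ 2 ≤ S → e ^ 2 ≤ S →
      PF0 ^ 2 ≤ 4 * (ω₂ ^ 2 + lam ^ 2 + 2 + 8 * β ^ 2) * S ^ 3 →
      G ^ 2 ≤ 4 * (ω₂ ^ 2 + lam ^ 2 + 2 + 8 * β ^ 2) * S ^ 3 →
      Bd ^ 2 ≤ (4 + 16 * β ^ 2) * S ^ 3 →
      PX0 ^ 2 ≤ 4 * (ω₂ ^ 2 + 9 * lam ^ 2 + 2 + 72 * β ^ 2) * S ^ 3 →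
      X1 ^ 2 ≤ 4 * (ω₂ ^ 2 + 9 * lam ^ 2 + 2 + 72 * β ^ 2) * S ^ 3 →
      Xb ^ 2 ≤ (4 + 144 * β ^ 2) * S ^ 3 →
      PW ^ 2 ≤ (2 + 72 * β ^ 2) * S ^ 2 →
      (γ * (G + ε * Bd) + (X1 + ε * Xb)) ^ 2 ≤ K * S ^ 4 ∧ (γ * PF0 + PX0) ^ 2 ≤ K * S ^ 4 ∧
        (d * (γ * (G + ε * Bd) + (X1 + ε * Xb))) ^ 2 ≤ K * S ^ 4 ∧ (e * (γ * PF0 + PX0)) ^ 2 ≤ K * S ^ 4 ∧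
        (d * (G + ε * Bd) - e * PF0) ^ 2 ≤ K * S ^ 4 ∧
        (d * (γ * (G + ε * Bd) + (X1 + ε * Xb)) - e * (γ * PF0 + PX0)) ^ 2 ≤ K * S ^ 4 ∧ PW ^ 2 ≤ K * S ^ 4 := by
  -- the constants
  have hK0 : 0 ≤ 4 * (ω₂ ^ 2 + lam ^ 2 + 2 + 8 * β ^ 2) := by positivity
  have hKX : 0 ≤ 4 * (ω₂ ^ 2 + 9 * lam ^ 2 + 2 + 72 * β ^ 2) := by positivity
  have hKb : 0 ≤ 4 + 16 * β ^ 2 := by positivity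
  have hKXb : 0 ≤ 4 + 144 * β ^ 2 := by positivity
  obtain ⟨KF1, hKF1⟩ : ∃ x : ℝ, x = 2 * (4 * (ω₂ ^ 2 + lam ^ 2 + 2 + 8 * β ^ 2)) + 2 * (4 + 16 * β ^ 2) := ⟨_, rfl⟩
  obtain ⟨KX1, hKX1⟩ : ∃ x : ℝ, x = 2 * (4 * (ω₂ ^ 2 + 9 * lam ^ 2 + 2 + 72 * β ^ 2)) + 2 * (4 + 144 * β ^ 2) :=
    ⟨_, rfl⟩
  obtain ⟨KA1, hKA1⟩ : ∃ x : ℝ, x = 2 * γ ^ 2 * (4 * (ω₂ ^ 2 + lam ^ 2 + 2 + 8 * β ^ 2)) +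
    2 * (4 * (ω₂ ^ 2 + 9 * lam ^ 2 + 2 + 72 * β ^ 2)) := ⟨_, rfl⟩
  obtain ⟨KA0, hKA0⟩ : ∃ x : ℝ, x = 2 * γ ^ 2 * KF1 + 2 * KX1 := ⟨_, rfl⟩
  have hKF1' : 0 ≤ KF1 := by rw [hKF1]; positivity
  have hKX1' : 0 ≤ KX1 := by rw [hKX1]; positivity
  have hKA1' : 0 ≤ KA1 := by rw [hKA1]; positivity
  have hKA0' : 0 ≤ KA0 := by rw [hKA0]; positivity
  refine ⟨3 * KA0 + 3 * KA1 + 2 * (KF1 + 4 * (ω₂ ^ 2 + lam ^ 2 + 2 + 8 * β ^ 2)) + (2 + 72 * β ^ 2), by positivity,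
    fun ε d e S PF0 G Bd PX0 X1 Xb PW hε0 hε1 hS1 hd he bF0 bG bBd bX0 bX1 bXb bW => ?_⟩
  have h0S : 0 ≤ S := zero_le_one.trans hS1
  have hS34 : S ^ 3 ≤ S ^ 4 := pow_le_pow_right₀ hS1 (by norm_num)
  have hS24 : S ^ 2 ≤ S ^ 4 := pow_le_pow_right₀ hS1 (by norm_num)
  have hS3 : 0 ≤ S ^ 3 := by positivity
  have hS4 : 0 ≤ S ^ 4 := by positivity
  -- composite bounds on `S³`
  have bF1 : (G + ε * Bd) ^ 2 ≤ KF1 * S ^ 3 := by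
    have := contact_sq_add_eps_mul_le G Bd ε hε0 hε1
    rw [hKF1]; linarith
  have bPX1 : (X1 + ε * Xb) ^ 2 ≤ KX1 * S ^ 3 := by
    have := contact_sq_add_eps_mul_le X1 Xb ε hε0 hε1
    rw [hKX1]; linarith
  have bA1 : (γ * PF0 + PX0) ^ 2 ≤ KA1 * S ^ 3 := by
    have := contact_sq_gamma_mul_add_le γ PF0 PX0
    have h1 := mul_le_mul_of_nonneg_left bF0 (sq_nonneg γ)
    rw [hKA1]; linarith
  have bA0 : (γ * (G + ε * Bd) + (X1 + ε * Xb)) ^ 2 ≤ KA0 * S ^ 3 := by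
    have := contact_sq_gamma_mul_add_le γ (G + ε * Bd) (X1 + ε * Xb)
    have h1 := mul_le_mul_of_nonneg_left bF1 (sq_nonneg γ)
    rw [hKA0]; linarith
  have hW0 : (0 : ℝ) ≤ 2 + 72 * β ^ 2 := by positivity
  have cA0 : KA0 ≤ 3 * KA0 + 3 * KA1 + 2 * (KF1 + 4 * (ω₂ ^ 2 + lam ^ 2 + 2 + 8 * β ^ 2)) + (2 + 72 * β ^ 2) := by
    linarith
  have cA1 : KA1 ≤ 3 * KA0 + 3 * KA1 + 2 * (KF1 + 4 * (ω₂ ^ 2 + lam ^ 2 + 2 + 8 * β ^ 2)) + (2 + 72 * β ^ 2) := by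
    linarith
  have cφ : 2 * (KF1 + 4 * (ω₂ ^ 2 + lam ^ 2 + 2 + 8 * β ^ 2)) ≤
      3 * KA0 + 3 * KA1 + 2 * (KF1 + 4 * (ω₂ ^ 2 + lam ^ 2 + 2 + 8 * β ^ 2)) + (2 + 72 * β ^ 2) := by linarith
  have ck : 2 * (KA0 + KA1) ≤ 3 * KA0 + 3 * KA1 + 2 * (KF1 + 4 * (ω₂ ^ 2 + lam ^ 2 + 2 + 8 * β ^ 2)) + (2 + 72 * β ^ 2) := by
    linarith
  have cW : 2 + 72 * β ^ 2 ≤ 3 * KA0 + 3 * KA1 + 2 * (KF1 + 4 * (ω₂ ^ 2 + lam ^ 2 + 2 + 8 * β ^ 2)) + (2 + 72 * β ^ 2) := by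
    linarith
  refine ⟨?_, ?_, ?_, ?_, ?_, ?_, ?_⟩
  · calc (γ * (G + ε * Bd) + (X1 + ε * Xb)) ^ 2 ≤ KA0 * S ^ 3 := bA0
      _ ≤ KA0 * S ^ 4 := mul_le_mul_of_nonneg_left hS34 hKA0'
      _ ≤ _ := mul_le_mul_of_nonneg_right cA0 hS4
  · calc (γ * PF0 + PX0) ^ 2 ≤ KA1 * S ^ 3 := bA1
      _ ≤ KA1 * S ^ 4 := mul_le_mul_of_nonneg_left hS34 hKA1'
      _ ≤ _ := mul_le_mul_of_nonneg_right cA1 hS4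
  · rw [mul_pow]
    calc d ^ 2 * (γ * (G + ε * Bd) + (X1 + ε * Xb)) ^ 2 ≤ S * (KA0 * S ^ 3) := mul_le_mul hd bA0 (sq_nonneg _) h0S
      _ = KA0 * S ^ 4 := by ring
      _ ≤ _ := mul_le_mul_of_nonneg_right cA0 hS4
  · rw [mul_pow]
    calc e ^ 2 * (γ * PF0 + PX0) ^ 2 ≤ S * (KA1 * S ^ 3) := mul_le_mul he bA1 (sq_nonneg _) h0S
      _ = KA1 * S ^ 4 := by ring
      _ ≤ _ := mul_le_mul_of_nonneg_right cA1 hS4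
  · calc (d * (G + ε * Bd) - e * PF0) ^ 2 ≤ 2 * S * ((G + ε * Bd) ^ 2 + PF0 ^ 2) := contact_sq_sub_mul_le hd he _ _
      _ ≤ 2 * S * (KF1 * S ^ 3 + 4 * (ω₂ ^ 2 + lam ^ 2 + 2 + 8 * β ^ 2) * S ^ 3) := by gcongr
      _ = (2 * (KF1 + 4 * (ω₂ ^ 2 + lam ^ 2 + 2 + 8 * β ^ 2))) * S ^ 4 := by ring
      _ ≤ _ := mul_le_mul_of_nonneg_right cφ hS4
  · calc (d * (γ * (G + ε * Bd) + (X1 + ε * Xb)) - e * (γ * PF0 + PX0)) ^ 2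
        ≤ 2 * S * ((γ * (G + ε * Bd) + (X1 + ε * Xb)) ^ 2 + (γ * PF0 + PX0) ^ 2) := contact_sq_sub_mul_le hd he _ _
      _ ≤ 2 * S * (KA0 * S ^ 3 + KA1 * S ^ 3) := by gcongr
      _ = (2 * (KA0 + KA1)) * S ^ 4 := by ring
      _ ≤ _ := mul_le_mul_of_nonneg_right ck hS4
  · calc PW ^ 2 ≤ (2 + 72 * β ^ 2) * S ^ 2 := bW
      _ ≤ (2 + 72 * β ^ 2) * S ^ 4 := mul_le_mul_of_nonneg_left hS24 hW0
      _ ≤ _ := mul_le_mul_of_nonneg_right cW hS4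

/-- **Registered helper `contact_realBounds` (R4 `stub_contactFormation`, line `cold-bath-relocation-walk`): ONE POLYNOMIAL MAJORANT FOR
THE LOCAL OBSERVABLES OF THE CURL CERTIFICATE.**  There is `K = K(ω₂, lam, β, γ) > 0` such that for all `ε ∈ [0, 1]` and all
reals `a, b, c, d, e, f` (`= q_0, q_1, q_{j₂}, p_0, p_1, p_{j₂}`), with `S = 1 + a² + b² + c² + d² + e² + f²`, the squares of
`A_0 = γF_1 + X_HF_1`, `A_1 = γF_0 + X_HF_0`, `p_0A_0`, `p_1A_1`, `φ = p_0F_1 − p_1F_0`, `k_φ = p_0A_0 − p_1A_1` and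
`W = V''(q_1 − q_0)` are all `≤ K S⁴` (explicit polynomials of the pinned chain: `U' = ω₂q + lam q³`, `V' = r + βr³`). [folklore] -/
theorem contact_realBounds : ∀ (ω₂ lam β γ : ℝ), ∃ K : ℝ, 0 < K ∧ ∀ (ε a b c d e f S : ℝ), 0 ≤ ε → ε ≤ 1 → S = 1 + a ^ 2 + b ^ 2 + c ^ 2 + d ^ 2 + e ^ 2 + f ^ 2 → (γ * (-(ω₂ * b + lam * b ^ 3) - ((b - a) + β * (b - a) ^ 3) + ε * ((c - b) + β * (c - b) ^ 3)) + (-(ω₂ + 3 * lam * b ^ 2) * e - (1 + 3 * β * (b - a) ^ 2) * (e - d) + ε * ((1 + 3 * β * (c - b) ^ 2) * (f - e)))) ^ 2 ≤ K * S ^ 4 ∧ (γ * (-(ω₂ * a + lam * a ^ 3) + ((b - a) + β * (b - a) ^ 3)) + (-(ω₂ + 3 * lam * a ^ 2) * d + (1 + 3 * β * (b - a) ^ 2) * (e - d))) ^ 2 ≤ K * S ^ 4 ∧ (d * (γ * (-(ω₂ * b + lam * b ^ 3) - ((b - a) + β * (b - a) ^ 3) + ε * ((c - b) + β * (c - b)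 ^ 3)) + (-(ω₂ + 3 * lam * b ^ 2) * e - (1 + 3 * β * (b - a) ^ 2) * (e - d) + ε * ((1 + 3 * β * (c - b) ^ 2) * (f - e))))) ^ 2 ≤ K * S ^ 4 ∧ (e * (γ * (-(ω₂ * a + lam * a ^ 3) + ((b - a) + β * (b - a) ^ 3)) + (-(ω₂ + 3 * lam * a ^ 2) * d + (1 + 3 * β * (b - a) ^ 2) * (e - d)))) ^ 2 ≤ K * S ^ 4 ∧ (d * (-(ω₂ * b + lam * b ^ 3) - ((b - a) + β * (b - a) ^ 3) + ε * ((c - b) + β * (c - b) ^ 3)) - e * (-(ω₂ * a + lam * a ^ 3) + ((b - a) + β * (b - a) ^ 3))) ^ 2 ≤ K * S ^ 4 ∧ (d * (γ * (-(ω₂ * b + lam * b ^ 3) - ((b - a) + β * (b - a) ^ 3) + ε * ((c - b) + β * (c - b) ^ 3)) + (-(ω₂ + 3 * lam * b ^ 2) * e - (1 + 3 * β * (b - a) ^ 2) * (e - d) + ε * ((1 + 3 * β * (c - b) ^ 2) * (f - e)))) - e * (γ * (-(ω₂ * a + lam * a ^ 3) + ((b - a) + β * (b - a) ^ 3)) +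 (-(ω₂ + 3 * lam * a ^ 2) * d + (1 + 3 * β * (b - a) ^ 2) * (e - d)))) ^ 2 ≤ K * S ^ 4 ∧ (1 + 3 * β * (b - a) ^ 2) ^ 2 ≤ K * S ^ 4 := by
  intro ω₂ lam β γ
  obtain ⟨K, hK, h⟩ := contact_realBounds_aux ω₂ lam β γ
  refine ⟨K, hK, fun ε a b c d e f S hε0 hε1 hS => ?_⟩
  have hS1 : 1 ≤ S := by
    rw [hS]; nlinarith [sq_nonneg a, sq_nonneg b, sq_nonneg c, sq_nonneg d, sq_nonneg e, sq_nonneg f]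
  have hd : d ^ 2 ≤ S := by rw [hS]; nlinarith [sq_nonneg a, sq_nonneg b, sq_nonneg c, sq_nonneg e, sq_nonneg f]
  have he : e ^ 2 ≤ S := by rw [hS]; nlinarith [sq_nonneg a, sq_nonneg b, sq_nonneg c, sq_nonneg d, sq_nonneg f]
  have hSab : 1 + a ^ 2 + b ^ 2 ≤ S := by rw [hS]; nlinarith [sq_nonneg c, sq_nonneg d, sq_nonneg e, sq_nonneg f]
  have hSba : 1 + b ^ 2 + a ^ 2 ≤ S := by linarith
  have hSbc : 1 + b ^ 2 + c ^ 2 ≤ S := by rw [hS]; nlinarith [sq_nonneg a, sq_nonneg d, sq_nonneg e, sq_nonneg f]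
  have hSabde : 1 + a ^ 2 + b ^ 2 + d ^ 2 + e ^ 2 ≤ S := by rw [hS]; nlinarith [sq_nonneg c, sq_nonneg f]
  have hSbaed : 1 + b ^ 2 + a ^ 2 + e ^ 2 + d ^ 2 ≤ S := by linarith
  have hSbcef : 1 + b ^ 2 + c ^ 2 + e ^ 2 + f ^ 2 ≤ S := by rw [hS]; nlinarith [sq_nonneg a, sq_nonneg d]
  have bG : (-(ω₂ * b + lam * b ^ 3) - ((b - a) + β * (b - a) ^ 3)) ^ 2 ≤
      4 * (ω₂ ^ 2 + lam ^ 2 + 2 + 8 * β ^ 2) * S ^ 3 := by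
    have h1 := contact_forceShape_sq_le ω₂ lam β b a S hSba
    have e1 : -(ω₂ * b + lam * b ^ 3) - ((b - a) + β * (b - a) ^ 3) =
        -(ω₂ * b + lam * b ^ 3) + ((a - b) + β * (a - b) ^ 3) := by ring
    rw [e1]; exact h1
  have bX1 : (-(ω₂ + 3 * lam * b ^ 2) * e - (1 + 3 * β * (b - a) ^ 2) * (e - d)) ^ 2 ≤
      4 * (ω₂ ^ 2 + 9 * lam ^ 2 + 2 + 72 * β ^ 2) * S ^ 3 := by
    have h1 := contact_flowShape_sq_le ω₂ lam β b a e d S hSbaed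
    have e1 : -(ω₂ + 3 * lam * b ^ 2) * e - (1 + 3 * β * (b - a) ^ 2) * (e - d) =
        -(ω₂ + 3 * lam * b ^ 2) * e + (1 + 3 * β * (a - b) ^ 2) * (d - e) := by ring
    rw [e1]; exact h1
  exact h ε d e S _ _ _ _ _ _ _ hε0 hε1 hS1 hd he (contact_forceShape_sq_le ω₂ lam β a b S hSab) bG
    (contact_bondShape_sq_le β b c S hSbc) (contact_flowShape_sq_le ω₂ lam β a b d e S hSabde) bX1
    (contact_bondFlowShape_sq_le β b c e f S hSbcef) (contact_curlShape_sq_le β a b S hSab)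

end Summit.AtomisticToContinuum.FouriersLaw.Cruxes.ConductanceLowerBound.ColdBathRelocationWalk
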